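import Mathlib
import Summits.NavierStokesRegularity.NavierStokesRegularity.Theorems.EulerZoomLiouvillePowerGaugeEulerLiouvilleSelfSimilarSaddleContinuumBadSet
import HarnessLib

/-!
# Rung C1 of the crux `EulerZoomLiouville.PowerGaugeEulerLiouville`: a drift coordinate from an ADAPTED RETRACTION onto
# the stagnation set (the differential-geometric form of the drift hypothesis)
# (route №10, item stmt-NavierStokesRegularity-19832; `--supports`)

Helper file (theorems only). Seat ns-typeII-p3 (cell ns-regularity-ideate §B, D-0081).  The exclusion theorems of
`…SelfSimilarSaddleContinuum(BadSet)` take an abstract DRIFT COORDINATE: a `C¹` map `f` with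
`‖Df(y) W(y)‖ ≤ C‖W(y)‖²` near the stagnation set, injective on it.  This file derives that estimate from the data a
tubular neighbourhood of a transversally nondegenerate stagnation curve provides — a retraction `π` onto `𝒩_W` — by a
two-term Taylor expansion at the foot point `π(y)`:

* **`norm_fderiv_apply_transport_le_of_adaptedRetraction`** — let `DV` be `L`-Lipschitz (so `DW = γI + DV` is too) and
  `‖DV‖ ≤ K`; on a set `U` let `π` be differentiable with `π(U) ⊆ 𝒩_W`, `‖Dπ‖ ≤ M_π`,
  `‖Dπ(y) − Dπ(π y)‖ ≤ L_π‖y − π(y)‖` (Lipschitz derivative along the fibres), ADAPTED at the foot points: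
  `Dπ(π y) ∘ DW(π y) = 0` (the fibres of `π` are tangent to `range DW` on `𝒩_W`; for the nearest-point retraction
  onto a curve of NON-VORTICAL nodes this is automatic, `DW(z)` being symmetric there with kernel the tangent line), and
  TRANSVERSALLY NONDEGENERATE: `c‖y − π(y)‖ ≤ ‖W(y)‖` on `U`.  Then
  `‖Dπ(y) W(y)‖ ≤ ((L_π(|γ| + K) + M_π L)/c²) ‖W(y)‖²` on `U` — i.e. `f = π` is a drift coordinate (and it is
  injective on `𝒩_W ∩ U`, where it is the identity);
* **`eq_zero_of_adaptedRetraction_of_dominatedBlock_on_badSet`** — the exclusion theorem of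
  `…SaddleContinuumBadSet` with the drift coordinate supplied by such a retraction (`π` globally `C¹`, the identity on
  `𝒩_W`, adapted and nondegenerate on an open `U ⊇ 𝒩_W`): `0 < γ < ½`, `V` smooth with (3.8) and `DV` Lipschitz,
  dominated block form at every bad node ⇒ `V ≡ 0`.

WHAT THIS IS NOT: not NS, not E, not rung C1 — the retraction `π` (a tubular-neighbourhood object) is a HYPOTHESIS;
its existence for a compact transversally nondegenerate `C²` stagnation curve is the tubular neighbourhood theorem,
not in the tree.  [folklore; cf. Aulbach1984 §2 (normal hyperbolicity of manifolds of equilibria);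
ConstantinIgnatovaVicol2026Putative §3.5]
-/

noncomputable section

-- flat `Theorems/<Route><Decl>…` files of one crux share the namespace of the crux (tree convention)
set_option linter.dupNamespace false

open MeasureTheory Set Filter Topology Metric Function InnerProductSpace
open scoped RealInnerProductSpace NNReal ContDiff

namespace Summit.NavierStokesRegularity.NavierStokesRegularity.Theorems.PowerGaugeEulerLiouville.Kelvin

open Literature.Analysis Literature.Analysis.FluidPDE Literature.Dynamics.FixedPoints

variable {γ : ℝ} {V : EuclideanSpace ℝ (Fin 3) → EuclideanSpace ℝ (Fin 3)} {P : EuclideanSpace ℝ (Fin 3) → ℝ}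

/-! ### Taylor expansion of `W` at a foot point -/

/-- **First-order Taylor bound for `W` at a stagnation point**: if `DV` is `L`-Lipschitz and `W(z) = 0`, then
`‖W(y) − DW(z)(y − z)‖ ≤ L‖y − z‖²`. [folklore] -/
theorem norm_transport_sub_fderiv_apply_le (hVd : Differentiable ℝ V) {L : ℝ≥0}
    (hDV : LipschitzWith L (fderiv ℝ V)) {z : EuclideanSpace ℝ (Fin 3)} (hz : z ∈ selfSimilarNodalSet γ 0 V)
    (y : EuclideanSpace ℝ (Fin 3)) :
    ‖selfSimilarTransport γ 0 V y -
        (γ • ContinuousLinearMap.id ℝ (EuclideanSpace ℝ (Fin 3)) + fderiv ℝ V z) (y - z)‖ ≤ (L : ℝ) * ‖y - z‖ ^ 2 := by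
  have hWd : ∀ x ∈ closedBall z ‖y - z‖, DifferentiableAt ℝ (selfSimilarTransport γ 0 V) x := fun x _ =>
    (hasFDerivAt_selfSimilarTransport hVd x).differentiableAt
  have hbound : ∀ x ∈ closedBall z ‖y - z‖, ‖fderiv ℝ (selfSimilarTransport γ 0 V) x -
      (γ • ContinuousLinearMap.id ℝ (EuclideanSpace ℝ (Fin 3)) + fderiv ℝ V z)‖ ≤ L * ‖y - z‖ := by
    intro x hx
    rw [(hasFDerivAt_selfSimilarTransport hVd x).fderiv, add_sub_add_left_eq_sub, ← dist_eq_norm]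
    calc dist (fderiv ℝ V x) (fderiv ℝ V z) ≤ L * dist x z := hDV.dist_le_mul x z
      _ ≤ L * ‖y - z‖ := by
          rw [mem_closedBall] at hx
          exact mul_le_mul_of_nonneg_left hx L.coe_nonneg
  have h := (convex_closedBall z ‖y - z‖).norm_image_sub_le_of_norm_fderiv_le' hWd hbound
    (mem_closedBall_self (norm_nonneg _)) (mem_closedBall.2 (by rw [dist_eq_norm]))
  have hWz : selfSimilarTransport γ 0 V z = 0 := hz
  rw [hWz, sub_zero] at h
  calc _ ≤ L * ‖y - z‖ * ‖y - z‖ := h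
    _ = (L : ℝ) * ‖y - z‖ ^ 2 := by ring

/-! ### Drift estimate from an adapted retraction -/

/-- **A DRIFT COORDINATE FROM AN ADAPTED RETRACTION.**  `DV` `L`-Lipschitz with `‖DV‖ ≤ K`; on `U`, `π` differentiable
with values in `𝒩_W`, `‖Dπ‖ ≤ M_π`, `‖Dπ(y) − Dπ(π y)‖ ≤ L_π‖y − π y‖`, adapted (`Dπ(π y) ∘ DW(π y) = 0`) and
transversally nondegenerate (`c‖y − π y‖ ≤ ‖W y‖`, `c > 0`).  Then for `y ∈ U`,
`‖Dπ(y) W(y)‖ ≤ ((L_π (|γ| + K) + M_π L)/c²) ‖W(y)‖²`. [folklore; cf. Aulbach1984 §2] -/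
theorem norm_fderiv_apply_transport_le_of_adaptedRetraction (hVd : Differentiable ℝ V) {K : ℝ}
    (hK : ∀ y, ‖fderiv ℝ V y‖ ≤ K) {L : ℝ≥0} (hDV : LipschitzWith L (fderiv ℝ V))
    {U : Set (EuclideanSpace ℝ (Fin 3))} {π : EuclideanSpace ℝ (Fin 3) → EuclideanSpace ℝ (Fin 3)}
    (hπN : ∀ y ∈ U, π y ∈ selfSimilarNodalSet γ 0 V) {Lπ Mπ c : ℝ} (hLπ : 0 ≤ Lπ) (hc : 0 < c)
    (hπM : ∀ y ∈ U, ‖fderiv ℝ π y‖ ≤ Mπ)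
    (hπLip : ∀ y ∈ U, ‖fderiv ℝ π y - fderiv ℝ π (π y)‖ ≤ Lπ * ‖y - π y‖)
    (hadapt : ∀ y ∈ U, (fderiv ℝ π (π y)).comp
      (γ • ContinuousLinearMap.id ℝ (EuclideanSpace ℝ (Fin 3)) + fderiv ℝ V (π y)) = 0)
    (hnondeg : ∀ y ∈ U, c * ‖y - π y‖ ≤ ‖selfSimilarTransport γ 0 V y‖) :
    ∀ y ∈ U, ‖fderiv ℝ π y (selfSimilarTransport γ 0 V y)‖ ≤
      ((Lπ * (|γ| + K) + Mπ * L) / c ^ 2) * ‖selfSimilarTransport γ 0 V y‖ ^ 2 := by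
  intro y hy
  set z := π y with hzdef
  set A : EuclideanSpace ℝ (Fin 3) →L[ℝ] EuclideanSpace ℝ (Fin 3) :=
    γ • ContinuousLinearMap.id ℝ (EuclideanSpace ℝ (Fin 3)) + fderiv ℝ V z with hA
  set d : ℝ := ‖y - z‖ with hd
  set w := selfSimilarTransport γ 0 V y with hw
  have hMπ0 : 0 ≤ Mπ := (norm_nonneg _).trans (hπM y hy)
  -- Taylor remainder `R = W(y) − A(y − z)`, `‖R‖ ≤ L d²`
  have hR : ‖w - A (y - z)‖ ≤ (L : ℝ) * d ^ 2 := norm_transport_sub_fderiv_apply_le hVd hDV (hπN y hy) y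
  -- `‖A‖ ≤ |γ| + K`
  have hAn : ‖A‖ ≤ |γ| + K := by
    rw [hA, ← (hasFDerivAt_selfSimilarTransport hVd z).fderiv]
    exact norm_fderiv_selfSimilarTransport_le (γ := γ) hVd hK z
  have hK0 : 0 ≤ |γ| + K := (norm_nonneg _).trans hAn
  -- decomposition: `Dπ(y) w = (Dπ(y) − Dπ(z)) (A (y − z)) + Dπ(z) (A (y − z)) + Dπ(y) R`, middle term zero
  have hmid : fderiv ℝ π z (A (y - z)) = 0 := by
    have h := congrArg (fun T : EuclideanSpace ℝ (Fin 3) →L[ℝ] EuclideanSpace ℝ (Fin 3) => T (y - z)) (hadapt y hy)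
    simpa [hA, hzdef] using h
  have hdec : fderiv ℝ π y w = (fderiv ℝ π y - fderiv ℝ π z) (A (y - z)) + fderiv ℝ π y (w - A (y - z)) := by
    have e1 : (fderiv ℝ π y - fderiv ℝ π z) (A (y - z)) = fderiv ℝ π y (A (y - z)) - fderiv ℝ π z (A (y - z)) :=
      rfl
    have e2 : fderiv ℝ π y (w - A (y - z)) = fderiv ℝ π y w - fderiv ℝ π y (A (y - z)) := map_sub _ _ _
    rw [e1, e2, hmid]; abel
  have h1 : ‖(fderiv ℝ π y - fderiv ℝ π z) (A (y - z))‖ ≤ Lπ * d * ((|γ| + K) * d) := by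
    calc _ ≤ ‖fderiv ℝ π y - fderiv ℝ π z‖ * ‖A (y - z)‖ := ContinuousLinearMap.le_opNorm _ _
      _ ≤ (Lπ * d) * ((|γ| + K) * d) := by
          refine mul_le_mul (hπLip y hy) ((A.le_opNorm _).trans (mul_le_mul_of_nonneg_right hAn (norm_nonneg _)))
            (norm_nonneg _) (by positivity)
      _ = Lπ * d * ((|γ| + K) * d) := by ring
  have h2 : ‖fderiv ℝ π y (w - A (y - z))‖ ≤ Mπ * ((L : ℝ) * d ^ 2) := by
    calc _ ≤ ‖fderiv ℝ π y‖ * ‖w - A (y - z)‖ := ContinuousLinearMap.le_opNorm _ _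
      _ ≤ Mπ * ((L : ℝ) * d ^ 2) := mul_le_mul (hπM y hy) hR (norm_nonneg _) hMπ0
  have h3 : ‖fderiv ℝ π y w‖ ≤ (Lπ * (|γ| + K) + Mπ * L) * d ^ 2 := by
    rw [hdec]
    calc _ ≤ ‖(fderiv ℝ π y - fderiv ℝ π z) (A (y - z))‖ + ‖fderiv ℝ π y (w - A (y - z))‖ := norm_add_le _ _
      _ ≤ Lπ * d * ((|γ| + K) * d) + Mπ * ((L : ℝ) * d ^ 2) := add_le_add h1 h2
      _ = (Lπ * (|γ| + K) + Mπ * L) * d ^ 2 := by ring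
  -- `d ≤ ‖w‖ / c`
  have hdw : d ≤ ‖w‖ / c := by
    rw [le_div_iff₀ hc, mul_comm]; exact hnondeg y hy
  have hd0 : 0 ≤ d := norm_nonneg _
  have hcoef : 0 ≤ Lπ * (|γ| + K) + Mπ * L := by positivity
  calc ‖fderiv ℝ π y w‖ ≤ (Lπ * (|γ| + K) + Mπ * L) * d ^ 2 := h3
    _ ≤ (Lπ * (|γ| + K) + Mπ * L) * (‖w‖ / c) ^ 2 :=
        mul_le_mul_of_nonneg_left (pow_le_pow_left₀ hd0 hdw 2) hcoef
    _ = ((Lπ * (|γ| + K) + Mπ * L) / c ^ 2) * ‖w‖ ^ 2 := by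
        field_simp

/-! ### The exclusion theorem with a retraction -/

/-- **EXCLUSION FOR TRANSVERSALLY-SADDLE BAD SETS, RETRACTION FORM.**  Let `(V, P)` be a classical self-similar Euler
profile, `V` smooth with `DV` Lipschitz, `0 < γ < ½`, far field (3.8).  Suppose a globally `C¹` map `π` is, on an
open `U ⊇ 𝒩_W`, a retraction onto `𝒩_W` (`π(U) ⊆ 𝒩_W`, `π = id` on `𝒩_W`) with bounded, fibrewise-Lipschitz
derivative, ADAPTED (`Dπ(π y) ∘ DW(π y) = 0`) and TRANSVERSALLY NONDEGENERATE (`c‖y − π y‖ ≤ ‖W y‖`); and suppose the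
linearisation at every BAD node has the dominated real block form.  Then `V ≡ 0`.
[cite: ConstantinIgnatovaVicol2026Putative, §3.5 Thm 3.10 (strengthened to transversally-saddle stagnation continua); Aulbach1984 Thm 2.3 (statement)] -/
theorem eq_zero_of_adaptedRetraction_of_dominatedBlock_on_badSet (hV : ContDiff ℝ ∞ V)
    (hprof : IsSelfSimilarEulerProfile γ 0 V P) (hγ : 0 < γ) (hγ2 : γ < 1 / 2)
    {C₀ : ℝ} (hfar : HasSelfSimilarFarFieldWith γ 0 C₀ V) {L : ℝ≥0} (hDV : LipschitzWith L (fderiv ℝ V))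
    (hblock : ∀ z ∈ selfSimilarNodalSet γ 0 V,
      (∃ w : EuclideanSpace ℝ (Fin 3), ‖w‖ = 1 ∧ 1 ≤ ⟪fderiv ℝ V z w, w⟫) →
      ∃ (b : Module.Basis (Fin 3) ℝ (EuclideanSpace ℝ (Fin 3))) (lam : Fin 3 → ℝ) (β : ℝ),
        (γ • ContinuousLinearMap.id ℝ (EuclideanSpace ℝ (Fin 3)) + fderiv ℝ V z) (b 0) = lam 0 • b 0 - β • b 1 ∧
        (γ • ContinuousLinearMap.id ℝ (EuclideanSpace ℝ (Fin 3)) + fderiv ℝ V z) (b 1) = β • b 0 + lam 1 • b 1 ∧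
        (γ • ContinuousLinearMap.id ℝ (EuclideanSpace ℝ (Fin 3)) + fderiv ℝ V z) (b 2) = lam 2 • b 2 ∧
        lam 2 < 0 ∧ lam 2 < lam 0 ∧ lam 2 < lam 1)
    {U : Set (EuclideanSpace ℝ (Fin 3))} (hU : IsOpen U) (hNU : selfSimilarNodalSet γ 0 V ⊆ U)
    {π : EuclideanSpace ℝ (Fin 3) → EuclideanSpace ℝ (Fin 3)} (hπ : ContDiff ℝ 1 π)
    (hπN : ∀ y ∈ U, π y ∈ selfSimilarNodalSet γ 0 V) (hπid : ∀ z ∈ selfSimilarNodalSet γ 0 V, π z = z)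
    {Lπ Mπ c : ℝ} (hLπ : 0 ≤ Lπ) (hc : 0 < c)
    (hπM : ∀ y ∈ U, ‖fderiv ℝ π y‖ ≤ Mπ)
    (hπLip : ∀ y ∈ U, ‖fderiv ℝ π y - fderiv ℝ π (π y)‖ ≤ Lπ * ‖y - π y‖)
    (hadapt : ∀ y ∈ U, (fderiv ℝ π (π y)).comp
      (γ • ContinuousLinearMap.id ℝ (EuclideanSpace ℝ (Fin 3)) + fderiv ℝ V (π y)) = 0)
    (hnondeg : ∀ y ∈ U, c * ‖y - π y‖ ≤ ‖selfSimilarTransport γ 0 V y‖) :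
    V = 0 := by
  have hK : ∀ y, ‖fderiv ℝ V y‖ ≤ C₀ := norm_fderiv_le_const_of_farField hγ hfar
  have hVd : Differentiable ℝ V := hV.differentiable (by simp)
  have hdrift := norm_fderiv_apply_transport_le_of_adaptedRetraction (γ := γ) hVd hK hDV hπN hLπ hc hπM hπLip
    hadapt hnondeg
  have hinj : InjOn π (selfSimilarNodalSet γ 0 V) := fun z hz z' hz' h => by rwa [hπid z hz, hπid z' hz'] at h
  exact eq_zero_of_driftCoordinate_of_dominatedBlock_on_badSet hV hprof hγ hγ2 hfar hblock hU hNU hπ hdrift hinj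

end Summit.NavierStokesRegularity.NavierStokesRegularity.Theorems.PowerGaugeEulerLiouville.Kelvin

end
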